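import Mathlib
import HarnessLib
import Summits.HubbardSuperconductivity.HubbardSuperconductivity.Theorems.KLProgrammeH10TwoPointLimitKlAnisoOffUmklappCount
import Summits.HubbardSuperconductivity.HubbardSuperconductivity.Theorems.KLProgrammeKLRegimeSplitOnWindow

/-!
# Route `KLProgramme` — K3 engine child `KLRegimeEngineV17F2` (stmt-HubbardSuperconductivity-20437), stub (b) `(Hμ)` re-sectorisation:
# the keyed off-class relative count («KEYED-R1-OFFCLASS», exponent `(m+1) − 3`) ON EVERY ADMISSIBLE FRAME IN THE KL REGIME and on `klWindowC`

Cell gate-hubbard-kl, seat p4 (C5a), g12.  `card_relCount_prescribed_offUmklapp_klAniso_le_frame` (`…KlAnisoOffUmklappCount`) read in the stub-(b)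
binders of k3c2-p3's jump lemmas — `FrameOK R U (nScales β) ν K`, `0 < c ≤ c₃`, `0 < U ≤ U₀`, `klBetaMin ≤ β ≤ e^{c/U²}` — with the class constant `C`,
the count constant `D` and the scale threshold `k₀` fixed BEFORE `R` (the `hRoff` slot of `EngineV8.hubbardSectorPrescribedSum_klAniso_jump_le_split`
with the umklapp-active class as `B`; the companion `hRon` slot is the last-leg row `EngineV8.card_relCount_prescribed_lastLeg_klAniso_le_window`):

* `card_relCount_prescribed_offUmklapp_klAniso_le_frameOK` — level windows with `-4 < μ₁ − 4·klE0`, `μ₂ + 4·klE0 < 0`;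
* `card_relCount_prescribed_offUmklapp_klAniso_le_window` — the covariance window `klWindowC = [-1.05, -0.15]` (`-0.15 + 1/8 < 0`).

Everything is PROVED; no definitions, no named facts.  References: BGM 2006 §2.7–§2.8, App. A3 Lemma A3.1 [cite: BenfattoGiulianiMastropietro2006];
BGM 2003 §3.1 Lemma 3.1 (4.3) [cite: BenfattoGiulianiMastropietro2003].
-/

noncomputable section

namespace Summit.HubbardSuperconductivity.HubbardSuperconductivity.Theorems.PerturbedFermiCurve

set_option linter.dupNamespace false -- summit = problem name (single-conjunct summit), D-0017

open Classical
open Real Set Finset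
open Literature.MathematicalPhysics.QuantumLattice Literature.MathematicalPhysics.QuantumLattice.BandSectorCounting
open Literature.Probability.LatticeModels
open Summit.HubbardSuperconductivity.HubbardSuperconductivity.Theorems.DispersionFlow
open Summit.HubbardSuperconductivity.HubbardSuperconductivity.Theorems.KLRegimeSplit
open Summit.HubbardSuperconductivity.HubbardSuperconductivity.Theorems.KLProgrammeLegKernels
open Summit.HubbardSuperconductivity.HubbardSuperconductivity.Theorems.TorusFourierL2

/-- **The keyed off-class relative count ON EVERY ADMISSIBLE FRAME IN THE KL REGIME** (`C, D, k₀` before `R`).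
[cite: BenfattoGiulianiMastropietro2006, App. A3 Lemma A3.1; BenfattoGiulianiMastropietro2003, §3.1 Lemma 3.1 (4.3)] -/
theorem card_relCount_prescribed_offUmklapp_klAniso_le_frameOK :
    ∀ μ₁ μ₂ : ℝ, -4 < μ₁ - 4 * klE0 → μ₁ ≤ μ₂ → μ₂ + 4 * klE0 < 0 →
      ∃ C : ℝ, 0 < C ∧ ∃ D : ℝ, 0 < D ∧ ∃ k₀ : ℕ, ∀ R : RenConsts, (∀ j, 0 ≤ R.Gfr j) →
      ∃ c₃ : ℝ, 0 < c₃ ∧ ∃ U₀ : ℝ, 0 < U₀ ∧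
      ∀ c : ℝ, 0 < c → c ≤ c₃ → ∀ U : ℝ, 0 < U → U ≤ U₀ → ∀ β : ℝ, klBetaMin ≤ β → β ≤ Real.exp (c / U ^ 2) →
      ∀ μ ∈ Set.Icc μ₁ μ₂, ∀ (ν : ℝ) (K : TrigPolyC4v), FrameOK R U (nScales β) ν K →
      ∀ (L M : ℕ) [NeZero L] (m k J' : ℕ), k₀ ≤ k → k ≤ J' → 3 ≤ m →
      ∀ (A'' : Finset (Fin (m + 1) → SectorLeg (sectorCount J'))),
        A'' ⊆ bgmSectorSet L M (klAnisoFamily L M β μ K klE0 J') (m + 1) →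
      ∀ (E : Finset (Fin (m + 1))) (τ'' : Fin (m + 1) → SectorLeg (sectorCount J')) (p : Fin (m + 1)), p ∈ E →
      ∀ σ' : Fin (m + 1) → SectorLeg (sectorCount k),
      (∀ G : Fin 2 → ℤ, G ≠ 0 → ∃ j : Fin 2, ((m : ℝ) + 1) * C * sectorWidth k <
          |∑ i, (if (σ' i).2 = 0 then klFermiPoint μ K (sectorCenter k (σ' i).1.1) j
              else -klFermiPoint μ K (sectorCenter k (σ' i).1.1) j) - 2 * π * (G j : ℝ)|) →
      ((((A''.filter fun σ'' => (∀ e ∈ E, σ'' e = τ'' e) ∧ ∀ i,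
          (∃ q : FreqMomentum L M, klAnisoFamily L M β μ K klE0 J' (σ'' i).1.1 q ≠ 0 ∧
            bgmFatMultiplier L M klE0 β (nambuXiCT L μ K) k (σ' i).1.1 q ≠ 0) ∧
          (σ' i).1.2 = (σ'' i).1.2 ∧ (σ' i).2 = (σ'' i).2).card : ℕ) : ℝ)) ≤
        D ^ (m + 1) * (2 : ℝ) ^ ((J' - k) * ((m + 1) - 3)) := by
  intro μ₁ μ₂ hμ₁ h12 hμ₂
  obtain ⟨κ, hκ, C, hC, D, hD, k₀, h⟩ := card_relCount_prescribed_offUmklapp_klAniso_le_frame μ₁ μ₂ hμ₁ h12 hμ₂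
  refine ⟨C, hC, D, hD, k₀, fun R hR => ?_⟩
  obtain ⟨c₃, hc₃, U₀, hU₀, hthr⟩ := frame_thresholds hR hκ
  refine ⟨c₃, hc₃, U₀, hU₀, ?_⟩
  intro c hc hcle U hU hUle β hβmin hβc μ hμ ν K hK L M _ m k J' hk₀ hkJ hm A'' hA'' E τ'' p hp σ' hoff
  exact h K _ (fun q j hj => norm_iteratedFDeriv_frameShift_le_of_frameOK_regime hR hc.le hβmin hβc hK q hj)
    (hthr c U hc.le hcle hU hUle) μ hμ L M β m k J' hk₀ hkJ hm A'' hA'' E τ'' p hp σ' hoff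

/-- **The keyed off-class relative count on the covariance window `klWindowC`** (`C, D, k₀` absolute; then the regime thresholds per `R`):
the `hRoff` row for the umklapp split of `EngineV8.hubbardSectorPrescribedSum_klAniso_jump_le_split`, exponent `(m+1) − 3`.
[cite: BenfattoGiulianiMastropietro2006, App. A3 Lemma A3.1; BenfattoGiulianiMastropietro2003, §3.1 Lemma 3.1 (4.3)] -/
theorem card_relCount_prescribed_offUmklapp_klAniso_le_window :
    ∃ C : ℝ, 0 < C ∧ ∃ D : ℝ, 0 < D ∧ ∃ k₀ : ℕ, ∀ R : RenConsts, (∀ j, 0 ≤ R.Gfr j) →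
      ∃ c₃ : ℝ, 0 < c₃ ∧ ∃ U₀ : ℝ, 0 < U₀ ∧
      ∀ c : ℝ, 0 < c → c ≤ c₃ → ∀ U : ℝ, 0 < U → U ≤ U₀ → ∀ β : ℝ, klBetaMin ≤ β → β ≤ Real.exp (c / U ^ 2) →
      ∀ μ ∈ klWindowC, ∀ (ν : ℝ) (K : TrigPolyC4v), FrameOK R U (nScales β) ν K →
      ∀ (L M : ℕ) [NeZero L] (m k J' : ℕ), k₀ ≤ k → k ≤ J' → 3 ≤ m →
      ∀ (A'' : Finset (Fin (m + 1) → SectorLeg (sectorCount J'))),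
        A'' ⊆ bgmSectorSet L M (klAnisoFamily L M β μ K klE0 J') (m + 1) →
      ∀ (E : Finset (Fin (m + 1))) (τ'' : Fin (m + 1) → SectorLeg (sectorCount J')) (p : Fin (m + 1)), p ∈ E →
      ∀ σ' : Fin (m + 1) → SectorLeg (sectorCount k),
      (∀ G : Fin 2 → ℤ, G ≠ 0 → ∃ j : Fin 2, ((m : ℝ) + 1) * C * sectorWidth k <
          |∑ i, (if (σ' i).2 = 0 then klFermiPoint μ K (sectorCenter k (σ' i).1.1) j
              else -klFermiPoint μ K (sectorCenter k (σ' i).1.1) j) - 2 * π * (G j : ℝ)|) →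
      ((((A''.filter fun σ'' => (∀ e ∈ E, σ'' e = τ'' e) ∧ ∀ i,
          (∃ q : FreqMomentum L M, klAnisoFamily L M β μ K klE0 J' (σ'' i).1.1 q ≠ 0 ∧
            bgmFatMultiplier L M klE0 β (nambuXiCT L μ K) k (σ' i).1.1 q ≠ 0) ∧
          (σ' i).1.2 = (σ'' i).1.2 ∧ (σ' i).2 = (σ'' i).2).card : ℕ) : ℝ)) ≤
        D ^ (m + 1) * (2 : ℝ) ^ ((J' - k) * ((m + 1) - 3)) :=
  card_relCount_prescribed_offUmklapp_klAniso_le_frameOK (-1.05) (-0.15) (by norm_num [klE0]) (by norm_num) (by norm_num [klE0])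

end Summit.HubbardSuperconductivity.HubbardSuperconductivity.Theorems.PerturbedFermiCurve

end
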